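import Literature.AlgebraicGeometry.Motives.HodgeNumberFibreSemicontinuity
import Literature.AlgebraicGeometry.Motives.ComplexPointsSubmersion
import Literature.AlgebraicGeometry.Motives.AlgPointsProperMapProofs
import Literature.AlgebraicGeometry.Motives.GAGAKaehlerImmersionProofs
import Literature.AlgebraicGeometry.HodgeTheory.AnalytificationImmersivePoint
import Literature.AlgebraicGeometry.HodgeTheory.HyperplaneSectionMonodromySmoothLocus
import Literature.AlgebraicGeometry.HodgeTheory.ComplexConjugationHolds
import Literature.AlgebraicGeometry.HodgeTheory.GlobalInvariantCyclesProofs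
import Literature.AlgebraicTopology.SingularHomology.FreeActionLefschetzNumber
import Literature.NumberTheory.Transcendental.AnalytificationCompactProofs
import HarnessLib

/-!
# Upper semicontinuity of the Hodge numbers of the fibres of a smooth projective family
(Voisin I, §9.3.2 Prop. 9.20 / Cor. 9.19)

Theorems-only file (no definitions, no named facts; D-0026). Let `f : 𝒳 ⟶ S` be a smooth
projective family of relative dimension `n` over a base `S` smooth of relative dimension `m` and
separated over `ℂ`, with `𝒳(ℂ)`, `S(ℂ)` second countable, and suppose the total space embeds
openly in a smooth projective variety, `j : 𝒳 ⟶ X̄` (as for the smooth part `π⁻¹(U) ⊆ X̃` of a net).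
Then for all `k p q`, every `s₀ ∈ S(ℂ)` and every Hodge model `A₀` of the fibre `𝒳_{s₀}`,
`dim A.hodgePQ k p q ≤ dim A₀.hodgePQ k p q` for `s` near `s₀` and every Hodge model `A` of `𝒳_s`
(`eventually_finrank_hodgePQ_le_of_isOpenImmersion`): Voisin (2002), §9.3.2, the upper
semicontinuity of `h^{p,q}(X_b) = dim ℋ^{p,q}(X_b)` underlying Prop. 9.20.

The analysis is the tree's theorem `le_finrank_hodgePQ_of_fibres` (file
`HodgeNumberFibreSemicontinuity`: for the fibres of a proper submersion into a Kähler manifold,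
parametrised by injective holomorphic immersions of compact complex manifolds, `dim K^{p,q}` can only
jump up in the limit). This file supplies its hypotheses from algebraic geometry (Serre, GAGA §2):
* `T := 𝒳(ℂ)` with the atlas of holomorphic algebraic charts (`ComplexPoints.algebraicChart`,
  `chartedSpaceOfCharts`; a complex manifold, `isManifold_algebraicChart`, of which `id` is an
  analytification, `isAnalytification_algebraicChart`), and similarly `B := S(ℂ)`, `X̄(ℂ)`;
* `X̄(ℂ)` is Kähler (`isKaehlerManifold_of_isAnalytification_of_isClosedImmersion_holds`, `X̄`
  projective) and the Kähler metric pulls back to `𝒳(ℂ)` along `j(ℂ)`, which is holomorphic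
  (`IsAnalytification.mdifferentiable_comp_map_holds`) with bijective differential
  (`surjective_mfderiv_map_algebraicChart`: the analytification of a SMOOTH morphism is a
  submersion, SGA1 XII Prop. 3.1 (iv), and `j` is an open immersion between equidimensional
  smooth schemes) (`exists_isKaehler_inner_eq_pullback`);
* `proj := f(ℂ) : 𝒳(ℂ) → S(ℂ)` is holomorphic, hence real `C^∞`, a submersion (same theorem, `f`
  smooth) and proper (`AlgPoints.isCompact_preimage_map`);
* the fibre over `s` is the image of the Hodge-model carrier `A.carrier ≅ 𝒳_s(ℂ)` under
  `ψ_A := (𝒳_s ↪ 𝒳)(ℂ) ∘ φ_A` (`AlgPoints.range_map_fiberι`), which is holomorphic (GAGA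
  functoriality), injective (`AlgPoints.map_fiberι_injective`) and immersive: composed with
  `j(ℂ)` and the comparison `X̄(ℂ) ≅ X̄^an` it is the analytified closed-then-open immersion
  `𝒳_s ↪ 𝒳 ↪ X̄` between Hodge models, immersive by
  `HodgeModel.injective_mfderiv_anMap_of_forall_exists_eval_eq` (Serre, GAGA §2 n°6);
* sequences suffice (`S(ℂ)` is second countable), and in degrees `k > 2n` both sides vanish
  (`subsingleton_singularCohomology_of_lt`).

## References

* [VoisinHodgeI2002] C. Voisin, Hodge Theory and Complex Algebraic Geometry I (2002), §9.3.2
  Prop. 9.20, Thm. 9.23.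
* [SerreGAGA1956] J.-P. Serre, Géométrie algébrique et géométrie analytique (1956), §2 n°5–6.
* [SGA1] A. Grothendieck, M. Raynaud, SGA 1, Exp. XII Prop. 3.1.
-/

noncomputable section

open scoped Manifold ContDiff Topology
open CategoryTheory AlgebraicGeometry Set Filter Function Module
open Literature.NumberTheory.Transcendental Literature.Geometry.Kaehler
open Literature.AlgebraicGeometry.HodgeTheory Literature.AlgebraicTopology.SingularHomology

namespace Literature.AlgebraicGeometry.Motives


/-! ### The algebraic-chart analytification `X(ℂ)` -/

section Atlas

variable (X : SchemeOver ℂ) (e : ℕ) [LocallyOfFiniteType X.hom] [SmoothOfRelativeDimension e X.hom]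

/-- **The holomorphic algebraic charts form a holomorphic atlas** on `X(ℂ)` (Serre, GAGA §2 n°5
Prop. 2: the coordinates of one chart are regular functions, read holomorphically in the other;
the tree's `isManifold_chartedSpaceOfCharts` with `ComplexPoints.algebraicChart_spec`).
[cite: SerreGAGA1956, §2 n°5 Prop. 2] -/
theorem isManifold_algebraicChart :
    @IsManifold ℂ _ _ _ _ _ _ 𝓘(ℂ, Fin e → ℂ) ω (ComplexPoints X) _
      (chartedSpaceOfCharts (ComplexPoints.algebraicChart X e)
        (ComplexPoints.mem_algebraicChart_source X e)) :=
  isManifold_chartedSpaceOfCharts _ _ (fun P ↦ (ComplexPoints.algebraicChart_spec X e P).1)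
    fun P ↦ (ComplexPoints.algebraicChart_spec X e P).2

/-- **`id : X(ℂ) → X(ℂ)` is an analytification** for the atlas of holomorphic algebraic charts
(regular functions are holomorphic in every algebraic chart, `ComplexPoints.algebraicChart_spec`;
the construction of `exists_isAnalytification_of_exists_algebraicChart`, for the tree's chosen
charts). [cite: SerreGAGA1956, §2 n°5 Prop. 2 and n°6 Prop. 3 Cor. 2] -/
theorem isAnalytification_algebraicChart :
    @IsAnalytification (Fin e → ℂ) _ _ _ (ComplexPoints X) _
      (chartedSpaceOfCharts (ComplexPoints.algebraicChart X e)
        (ComplexPoints.mem_algebraicChart_source X e)) ℂ _ _ X e id := by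
  letI cs : ChartedSpace (Fin e → ℂ) (ComplexPoints X) :=
    chartedSpaceOfCharts (ComplexPoints.algebraicChart X e)
      (ComplexPoints.mem_algebraicChart_source X e)
  haveI : IsManifold 𝓘(ℂ, Fin e → ℂ) ω (ComplexPoints X) := isManifold_algebraicChart X e
  refine ⟨IsHomeomorph.id, by simp, fun U s P hP ↦ ?_⟩
  simp only [Set.preimage_id_eq, id_eq, Set.mem_setOf_eq] at hP
  refine MDifferentiableAt.mdifferentiableWithinAt ?_
  rw [mdifferentiableAt_iff]
  refine ⟨(AlgPoints.continuousOn_evalOrZero _ s).continuousAt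
    ((AlgPoints.isOpen_setOf_pt_mem _).mem_nhds hP), ?_⟩
  simp only [writtenInExtChartAt, extChartAt, OpenPartialHomeomorph.extend,
    modelWithCornersSelf_partialEquiv, PartialEquiv.trans_refl, modelWithCornersSelf_coe,
    Set.range_id, OpenPartialHomeomorph.toFun_eq_coe,
    OpenPartialHomeomorph.coe_toPartialEquiv_symm]
  refine DifferentiableAt.differentiableWithinAt ?_
  set c := ComplexPoints.algebraicChart X e P with hc
  have hopen : IsOpen (c.target ∩ c.symm ⁻¹' {Q | Q.pt ∈ (↑U : X.left.Opens)}) :=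
    c.isOpen_inter_preimage_symm (AlgPoints.isOpen_setOf_pt_mem _)
  have hmem : c P ∈ c.target ∩ c.symm ⁻¹' {Q | Q.pt ∈ (↑U : X.left.Opens)} :=
    ⟨c.map_source (ComplexPoints.mem_algebraicChart_source X e P), by
      simp only [Set.mem_preimage, Set.mem_setOf_eq,
        c.left_inv (ComplexPoints.mem_algebraicChart_source X e P)]
      exact hP⟩
  exact (((ComplexPoints.algebraicChart_spec X e P).2 U s).differentiableOn (by simp)).differentiableAt
    (hopen.mem_nhds hmem)

end Atlas

/-! ### The analytification of a smooth morphism is a submersion (holomorphic atlases) -/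

section Submersion

variable {X Y : SchemeOver ℂ} {e e' : ℕ} [LocallyOfFiniteType X.hom] [SmoothOfRelativeDimension e X.hom]
  [LocallyOfFiniteType Y.hom] [SmoothOfRelativeDimension e' Y.hom]

/-- **`f(ℂ)` is a holomorphic submersion for `f` smooth** (SGA1 XII Prop. 3.1 (iv)), in the atlases
of holomorphic algebraic charts: the complex manifold derivative of `f(ℂ) : X(ℂ) → Y(ℂ)` at every
point is onto. The chart expression is the one of `surjective_fderiv_chart_map` (tangent vectors as
point derivations extended along the formally smooth comorphism); cf. the real-atlas form
`ComplexPoints.surjective_mfderiv_map`. [cite: SGA1, Exp. XII Prop. 3.1 (iv)] -/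
theorem surjective_mfderiv_map_algebraicChart (f : X ⟶ Y) [Smooth f.left] (P : ComplexPoints X) :
    letI := chartedSpaceOfCharts (ComplexPoints.algebraicChart X e)
      (ComplexPoints.mem_algebraicChart_source X e)
    letI := chartedSpaceOfCharts (ComplexPoints.algebraicChart Y e')
      (ComplexPoints.mem_algebraicChart_source Y e')
    Surjective (mfderiv 𝓘(ℂ, Fin e → ℂ) 𝓘(ℂ, Fin e' → ℂ)
      (AlgPoints.map f : ComplexPoints X → ComplexPoints Y) P) := by
  letI csX := chartedSpaceOfCharts (ComplexPoints.algebraicChart X e)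
    (ComplexPoints.mem_algebraicChart_source X e)
  letI csY := chartedSpaceOfCharts (ComplexPoints.algebraicChart Y e')
    (ComplexPoints.mem_algebraicChart_source Y e')
  classical
  set Q := AlgPoints.map f P with hQdef
  set aX := ComplexPoints.algebraicChart X e P with haX
  set aY := ComplexPoints.algebraicChart Y e' Q with haY
  obtain ⟨⟨V₁, u, hsrcY, hu⟩, holY⟩ := ComplexPoints.algebraicChart_spec Y e' Q
  obtain ⟨algX, holX⟩ := ComplexPoints.algebraicChart_spec X e P
  have hP : P ∈ aX.source := ComplexPoints.mem_algebraicChart_source X e P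
  have hQ : Q ∈ aY.source := ComplexPoints.mem_algebraicChart_source Y e' Q
  have hQV₁ : Q.pt ∈ (↑V₁ : Y.left.Opens) := hsrcY hQ
  obtain ⟨U, hPU, hle, t, htspan⟩ :=
    exists_localCoordinates_le e P (f.left ⁻¹ᵁ ↑V₁) (show P.pt ∈ f.left ⁻¹ᵁ ↑V₁ from hQV₁)
  obtain ⟨hdiff, hsurj⟩ := surjective_fderiv_chart_map f aX hP holX algX aY hQ holY V₁ u hsrcY hu
    U hPU hle t htspan
  set G : (Fin e → ℂ) → (Fin e' → ℂ) := aY ∘ AlgPoints.map f ∘ aX.symm with hGdef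
  have hwritten : writtenInExtChartAt 𝓘(ℂ, Fin e → ℂ) 𝓘(ℂ, Fin e' → ℂ) P
      (AlgPoints.map f : ComplexPoints X → ComplexPoints Y) = G := by
    funext z
    rfl
  have hpt : extChartAt 𝓘(ℂ, Fin e → ℂ) P P = aX P := rfl
  have hmf : HasMFDerivAt 𝓘(ℂ, Fin e → ℂ) 𝓘(ℂ, Fin e' → ℂ)
      (AlgPoints.map f : ComplexPoints X → ComplexPoints Y) P (fderiv ℂ G (aX P)) := by
    refine ⟨(AlgPoints.continuous_map f).continuousAt, ?_⟩
    rw [hwritten, hpt]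
    exact hdiff.hasFDerivAt.hasFDerivWithinAt
  rw [hmf.mfderiv]
  exact hsurj

end Submersion

/-! ### Holomorphic maps: real differential -/

section RealOfComplex

variable {E : Type*} [NormedAddCommGroup E] [NormedSpace ℂ E] {E' : Type*} [NormedAddCommGroup E']
  [NormedSpace ℂ E'] {M : Type*} [TopologicalSpace M] [ChartedSpace E M]
  {M' : Type*} [TopologicalSpace M'] [ChartedSpace E' M'] {f : M → M'} {x : M}

/-- The real differential of a holomorphic map commutes with `J` (it is `ℂ`-linear,
`mfderiv_real_apply_smul`). [cite: VoisinHodgeI2002, §2.2.1] -/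
theorem mfderiv_real_tangentJ (hf : MDifferentiableAt 𝓘(ℂ, E) 𝓘(ℂ, E') f x)
    (v : TangentSpace 𝓘(ℝ, E) x) :
    mfderiv 𝓘(ℝ, E) 𝓘(ℝ, E') f x (tangentJ E x v) =
      tangentJ E' (f x) (mfderiv 𝓘(ℝ, E) 𝓘(ℝ, E') f x v) := by
  rw [tangentJ_apply, tangentJ_apply]
  exact mfderiv_real_apply_smul hf Complex.I v

/-- The real differential of a holomorphic map is injective iff the complex one is (same map,
`mfderiv_real_eq_restrictScalars`). [cite: VoisinHodgeI2002, §2.2.1] -/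
theorem injective_mfderiv_real_of_complex (hf : MDifferentiableAt 𝓘(ℂ, E) 𝓘(ℂ, E') f x)
    (h : Injective (mfderiv 𝓘(ℂ, E) 𝓘(ℂ, E') f x)) :
    Injective (mfderiv 𝓘(ℝ, E) 𝓘(ℝ, E') f x) := by
  rw [mfderiv_real_eq_restrictScalars hf]
  exact h

/-- The real differential of a holomorphic map is onto iff the complex one is (same map).
[cite: VoisinHodgeI2002, §2.2.1] -/
theorem surjective_mfderiv_real_of_complex (hf : MDifferentiableAt 𝓘(ℂ, E) 𝓘(ℂ, E') f x)
    (h : Surjective (mfderiv 𝓘(ℂ, E) 𝓘(ℂ, E') f x)) :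
    Surjective (mfderiv 𝓘(ℝ, E) 𝓘(ℝ, E') f x) := by
  rw [mfderiv_real_eq_restrictScalars hf]
  exact h

end RealOfComplex

/-! ### The theorem -/

section Family

variable {𝒳 S Xbar : SchemeOver ℂ} (f : 𝒳 ⟶ S) {n m d : ℕ}

set_option maxHeartbeats 1600000 in
/-- **Upper semicontinuity of the Hodge numbers of the fibres** (Voisin (2002), §9.3.2, the
inequality `h^{p,q}(X_b) ≤ h^{p,q}(X_0)` for `b` near `0` behind Prop. 9.20). Let `f : 𝒳 ⟶ S` be a
smooth projective family of relative dimension `n` over `S` smooth of relative dimension `m` and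
separated over `ℂ`, with `𝒳(ℂ)` and `S(ℂ)` second countable, and let `j : 𝒳 ⟶ X̄` be an open
immersion into a smooth projective variety of dimension `d = n + m`. Then for all `k p q`, every
`s₀ ∈ S(ℂ)` and every Hodge model `A₀` of `𝒳_{s₀}`: for `s` near `s₀` and every Hodge model `A` of
`𝒳_s`, `dim A.hodgePQ k p q ≤ dim A₀.hodgePQ k p q`. Proof: the module docstring (the analytic
theorem `le_finrank_hodgePQ_of_fibres` applied to `f(ℂ) : 𝒳(ℂ) → S(ℂ)` with the Kähler metric
pulled back from `X̄(ℂ)`, the fibres parametrised by the Hodge-model carriers).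
[cite: VoisinHodgeI2002, §9.3.2 Prop. 9.20] -/
theorem eventually_finrank_hodgePQ_le_of_isOpenImmersion [SmoothOfRelativeDimension m S.hom]
    [IsSeparated S.hom] [SecondCountableTopology (ComplexPoints 𝒳)]
    [SecondCountableTopology (ComplexPoints S)] (hf : IsSmoothProjectiveFamily f n)
    (hX : IsSmoothProjective d Xbar) (hd : d = n + m) (j : 𝒳 ⟶ Xbar) [IsOpenImmersion j.left]
    (k p q : ℕ) (s₀ : ComplexPoints S) (A₀ : HodgeModel n (fiberOver f s₀)) :
    ∀ᶠ s in 𝓝 s₀, ∀ A : HodgeModel n (fiberOver f s),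
      finrank ℂ ↥(A.hodgePQ k p q) ≤ finrank ℂ ↥(A₀.hodgePQ k p q) := by
  classical
  /- ### Instances -/
  haveI : IsProper f.left := hf.isProper
  haveI : SmoothOfRelativeDimension n f.left := hf.smoothOfRelativeDimension
  haveI : SmoothOfRelativeDimension (n + m) 𝒳.hom := by rw [← Over.w f]; infer_instance
  haveI : Smooth S.hom := SmoothOfRelativeDimension.smooth m _
  haveI : Smooth 𝒳.hom := SmoothOfRelativeDimension.smooth (n + m) _
  haveI : LocallyOfFiniteType S.hom := inferInstance
  haveI : LocallyOfFiniteType 𝒳.hom := inferInstance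
  haveI : IsSeparated 𝒳.hom := by rw [← Over.w f]; infer_instance
  haveI : SmoothOfRelativeDimension d Xbar.hom := hX.smoothOfRelativeDimension
  haveI : IsProper Xbar.hom := IsSmoothProjective.isProper_holds hX
  haveI : Smooth Xbar.hom := SmoothOfRelativeDimension.smooth d _
  haveI : LocallyOfFiniteType Xbar.hom := inferInstance
  haveI : T2Space (ComplexPoints 𝒳) := ComplexPoints.t2Space_of_isSeparated 𝒳
  haveI : T2Space (ComplexPoints S) := ComplexPoints.t2Space_of_isSeparated S
  haveI : T2Space (ComplexPoints Xbar) := ComplexPoints.t2Space_of_isSeparated Xbar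
  /- ### The holomorphic algebraic atlases on `𝒳(ℂ)`, `S(ℂ)`, `X̄(ℂ)` -/
  letI csT : ChartedSpace (Fin (n + m) → ℂ) (ComplexPoints 𝒳) :=
    chartedSpaceOfCharts (ComplexPoints.algebraicChart 𝒳 (n + m))
      (ComplexPoints.mem_algebraicChart_source 𝒳 (n + m))
  letI csB : ChartedSpace (Fin m → ℂ) (ComplexPoints S) :=
    chartedSpaceOfCharts (ComplexPoints.algebraicChart S m)
      (ComplexPoints.mem_algebraicChart_source S m)
  letI csX : ChartedSpace (Fin d → ℂ) (ComplexPoints Xbar) :=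
    chartedSpaceOfCharts (ComplexPoints.algebraicChart Xbar d)
      (ComplexPoints.mem_algebraicChart_source Xbar d)
  haveI : IsManifold 𝓘(ℂ, Fin (n + m) → ℂ) ω (ComplexPoints 𝒳) := isManifold_algebraicChart 𝒳 _
  haveI : IsManifold 𝓘(ℂ, Fin m → ℂ) ω (ComplexPoints S) := isManifold_algebraicChart S _
  haveI : IsManifold 𝓘(ℂ, Fin d → ℂ) ω (ComplexPoints Xbar) := isManifold_algebraicChart Xbar _
  haveI : IsManifold 𝓘(ℝ, Fin (n + m) → ℂ) ∞ (ComplexPoints 𝒳) :=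
    isManifold_real_of_isManifold_complex
  haveI : IsManifold 𝓘(ℝ, Fin m → ℂ) ∞ (ComplexPoints S) := isManifold_real_of_isManifold_complex
  haveI : IsManifold 𝓘(ℝ, Fin d → ℂ) ∞ (ComplexPoints Xbar) :=
    isManifold_real_of_isManifold_complex
  have hφT : IsAnalytification (Fin (n + m) → ℂ) 𝒳 (n + m) (id : ComplexPoints 𝒳 → _) :=
    isAnalytification_algebraicChart 𝒳 _
  have hφB : IsAnalytification (Fin m → ℂ) S m (id : ComplexPoints S → _) :=
    isAnalytification_algebraicChart S _
  have hφX : IsAnalytification (Fin d → ℂ) Xbar d (id : ComplexPoints Xbar → _) :=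
    isAnalytification_algebraicChart Xbar _
  /- ### `j(ℂ)`: holomorphic with bijective differential; the Kähler metric on `𝒳(ℂ)` -/
  obtain ⟨N', ι, hι⟩ := hX.isProjectiveOver
  haveI := hι
  haveI : IsKaehlerManifold (Fin d → ℂ) (ComplexPoints Xbar) :=
    isKaehlerManifold_of_isAnalytification_of_isClosedImmersion_holds ι hφX
  obtain ⟨GX, hGX⟩ := IsKaehlerManifold.exists_isKaehler (E := Fin d → ℂ) (M := ComplexPoints Xbar)
  have hjhol : MDifferentiable 𝓘(ℂ, Fin (n + m) → ℂ) 𝓘(ℂ, Fin d → ℂ)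
      (AlgPoints.map j : ComplexPoints 𝒳 → ComplexPoints Xbar) :=
    IsAnalytification.mdifferentiable_comp_map_holds hφT hφX j (AlgPoints.map j) rfl
  haveI : Smooth j.left := inferInstance
  have hjD : ∀ x, Injective (mfderiv 𝓘(ℝ, Fin (n + m) → ℂ) 𝓘(ℝ, Fin d → ℂ)
      (AlgPoints.map j : ComplexPoints 𝒳 → ComplexPoints Xbar) x) := by
    intro x
    refine injective_mfderiv_real_of_complex (hjhol x) ?_
    have hs := surjective_mfderiv_map_algebraicChart (e := n + m) (e' := d) j x
    set L := (mfderiv 𝓘(ℂ, Fin (n + m) → ℂ) 𝓘(ℂ, Fin d → ℂ)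
      (AlgPoints.map j : ComplexPoints 𝒳 → ComplexPoints Xbar) x : (Fin (n + m) → ℂ) →L[ℂ] (Fin d → ℂ))
    have hdim : finrank ℂ (Fin (n + m) → ℂ) = finrank ℂ (Fin d → ℂ) := by simp [hd]
    exact (LinearMap.injective_iff_surjective_of_finrank_eq_finrank hdim (f := L.toLinearMap)).2 hs
  obtain ⟨GT, hGT, -⟩ := exists_isKaehler_inner_eq_pullback GX hGX hjhol.contMDiff_real_of_complex
    (fun x v ↦ mfderiv_real_tangentJ (hjhol x) v) hjD
  /- ### `f(ℂ)`: a proper real submersion -/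
  set proj : ComplexPoints 𝒳 → ComplexPoints S := AlgPoints.map f with hproj
  have hprojhol : MDifferentiable 𝓘(ℂ, Fin (n + m) → ℂ) 𝓘(ℂ, Fin m → ℂ) proj :=
    IsAnalytification.mdifferentiable_comp_map_holds hφT hφB f proj rfl
  have hπ : ContMDiff 𝓘(ℝ, Fin (n + m) → ℂ) 𝓘(ℝ, Fin m → ℂ) ∞ proj :=
    hprojhol.contMDiff_real_of_complex
  haveI : Smooth f.left := hf.smooth
  have hsub : ∀ x, proj x ∈ (univ : Set (ComplexPoints S)) →
      Surjective (mfderiv 𝓘(ℝ, Fin (n + m) → ℂ) 𝓘(ℝ, Fin m → ℂ) proj x) := fun x _ ↦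
    surjective_mfderiv_real_of_complex (hprojhol x)
      (surjective_mfderiv_map_algebraicChart (e := n + m) (e' := m) f x)
  have hprop : ∀ K ⊆ (univ : Set (ComplexPoints S)), IsCompact K → IsCompact (proj ⁻¹' K) :=
    fun K _ hK ↦ AlgPoints.isCompact_preimage_map f hK
  /- ### The fibre embeddings `ψ_A : A.carrier → 𝒳(ℂ)` of the Hodge-model carriers -/
  obtain ⟨AX⟩ : Nonempty (HodgeModel d Xbar) := nonempty_hodgeModel_holds hX
  -- the comparison `X̄(ℂ) → X̄^an` is holomorphic
  set cX : ComplexPoints Xbar → AX.carrier := ⇑(AX.isAnalytification.homeomorph.symm) with hcX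
  have hcXhol : MDifferentiable 𝓘(ℂ, Fin d → ℂ) 𝓘(ℂ, AX.model) cX := by
    refine IsAnalytification.mdifferentiable_comp_map_holds hφX AX.isAnalytification (𝟙 Xbar) cX ?_
    funext y
    simp only [Function.comp_apply, AlgPoints.map_id_apply, id_eq, hcX]
    exact AX.isAnalytification.homeomorph.apply_symm_apply y
  have hfib : ∀ (s : ComplexPoints S) (A : HodgeModel n (fiberOver f s)),
      ContMDiff 𝓘(ℝ, A.model) 𝓘(ℝ, Fin (n + m) → ℂ) ∞
          (fun a ↦ AlgPoints.map (fiberι f s) (A.toComplexPoints a)) ∧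
        Injective (fun a ↦ AlgPoints.map (fiberι f s) (A.toComplexPoints a)) ∧
        (∀ x, Injective (mfderiv 𝓘(ℝ, A.model) 𝓘(ℝ, Fin (n + m) → ℂ)
          (fun a ↦ AlgPoints.map (fiberι f s) (A.toComplexPoints a)) x)) ∧
        (∀ (x : A.carrier) (v : TangentSpace 𝓘(ℝ, A.model) x),
          mfderiv 𝓘(ℝ, A.model) 𝓘(ℝ, Fin (n + m) → ℂ)
              (fun a ↦ AlgPoints.map (fiberι f s) (A.toComplexPoints a)) x (tangentJ A.model x v) =
            tangentJ (Fin (n + m) → ℂ) (AlgPoints.map (fiberι f s) (A.toComplexPoints x))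
              (mfderiv 𝓘(ℝ, A.model) 𝓘(ℝ, Fin (n + m) → ℂ)
                (fun a ↦ AlgPoints.map (fiberι f s) (A.toComplexPoints a)) x v)) ∧
        range (fun a ↦ AlgPoints.map (fiberι f s) (A.toComplexPoints a)) = proj ⁻¹' {s} := by
    intro s A
    have hXs : IsSmoothProjective n (fiberOver f s) := hf.isSmoothProjective s
    haveI : SmoothOfRelativeDimension n (fiberOver f s).hom := hXs.smoothOfRelativeDimension
    haveI : Smooth (fiberOver f s).hom := SmoothOfRelativeDimension.smooth n _
    haveI : LocallyOfFiniteType (fiberOver f s).hom := inferInstance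
    haveI : CompleteSpace (Fin (n + m) → ℂ) := inferInstance
    set ψ : A.carrier → ComplexPoints 𝒳 := fun a ↦ AlgPoints.map (fiberι f s) (A.toComplexPoints a)
      with hψdef
    have hhol : MDifferentiable 𝓘(ℂ, A.model) 𝓘(ℂ, Fin (n + m) → ℂ) ψ :=
      IsAnalytification.mdifferentiable_comp_map_holds A.isAnalytification hφT (fiberι f s) ψ rfl
    refine ⟨hhol.contMDiff_real_of_complex,
      (AlgPoints.map_fiberι_injective f s).comp A.isAnalytification.isHomeomorph.injective,
      fun x ↦ injective_mfderiv_real_of_complex (hhol x) ?_,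
      fun x v ↦ mfderiv_real_tangentJ (hhol x) v, ?_⟩
    · -- immersivity: `cX ∘ j(ℂ) ∘ ψ` is the analytified `𝒳_s ↪ 𝒳 ↪ X̄` between Hodge models
      set τ : fiberOver f s ⟶ Xbar := fiberι f s ≫ j with hτ
      have hτst : ∀ P : ComplexPoints (fiberOver f s), Surjective (τ.left.stalkMap P.pt) := by
        intro P
        haveI : IsClosedImmersion (fiberι f s).left := by
          rw [fiberι_left]
          exact MorphismProperty.pullback_fst (P := @IsClosedImmersion) f.left s.left
            (isClosedImmersion_left_of_algPoints s)
        haveI : IsIso (j.left.stalkMap ((fiberι f s).left.base P.pt)) :=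
          (IsOpenImmersion.iff_isIso_stalkMap.1 inferInstance).2 _
        rw [hτ, Over.comp_left, Scheme.Hom.stalkMap_comp]
        intro t
        obtain ⟨u, rfl⟩ := (fiberι f s).left.stalkMap_surjective P.pt t
        obtain ⟨v, rfl⟩ := (ConcreteCategory.bijective_of_isIso
          (j.left.stalkMap ((fiberι f s).left.base P.pt))).2 u
        exact ⟨v, rfl⟩
      have hinj := HodgeModel.injective_mfderiv_anMap_of_forall_exists_eval_eq AX A hX hXs τ x
        fun U sU hPU ↦ exists_eval_eq_of_stalkMap_surjective τ _ (hτst _) U sU hPU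
      have he : HodgeModel.anMap AX A τ = cX ∘ ((AlgPoints.map j : ComplexPoints 𝒳 → _) ∘ ψ) := by
        funext b
        change AX.isAnalytification.homeomorph.symm (AlgPoints.map τ (A.toComplexPoints b)) =
          AX.isAnalytification.homeomorph.symm
            (AlgPoints.map j (AlgPoints.map (fiberι f s) (A.toComplexPoints b)))
        rw [hτ, AlgPoints.map_comp_apply]
      rw [he, mfderiv_comp x (hcXhol _) ((hjhol _).comp x (hhol x)),
        mfderiv_comp x (hjhol _) (hhol x)] at hinj
      have hinj' : Injective
          (⇑(mfderiv 𝓘(ℂ, Fin d → ℂ) 𝓘(ℂ, AX.model) cX ((AlgPoints.map j ∘ ψ) x)) ∘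
            (⇑(mfderiv 𝓘(ℂ, Fin (n + m) → ℂ) 𝓘(ℂ, Fin d → ℂ)
                (AlgPoints.map j : ComplexPoints 𝒳 → ComplexPoints Xbar) (ψ x)) ∘
              ⇑(mfderiv 𝓘(ℂ, A.model) 𝓘(ℂ, Fin (n + m) → ℂ) ψ x))) := hinj
      exact hinj'.of_comp.of_comp
    · change range ((AlgPoints.map (fiberι f s) : ComplexPoints (fiberOver f s) → ComplexPoints 𝒳) ∘
        A.toComplexPoints) = _
      rw [Set.range_comp (AlgPoints.map (fiberι f s)) A.toComplexPoints,
        A.isAnalytification.isHomeomorph.surjective.range_eq, Set.image_univ,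
        AlgPoints.range_map_fiberι]
  /- ### Hodge numbers through the de Rham comparison of the model -/
  have hfin : ∀ (s : ComplexPoints S) (A : HodgeModel n (fiberOver f s)) (k p q : ℕ),
      finrank ℂ ↥(A.hodgePQ k p q) = finrank ℂ ↥(hodgePQ A.model A.carrier k p q) :=
    fun s A k p q ↦ LinearEquiv.finrank_map_eq _ _
  -- compactness and real dimension of the carriers
  have hcpt : ∀ (s : ComplexPoints S) (A : HodgeModel n (fiberOver f s)), CompactSpace A.carrier := by
    intro s A
    haveI : IsProper (fiberOver f s).hom := isProper_fiberOver_hom f s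
    haveI : CompactSpace (ComplexPoints (fiberOver f s)) :=
      compactSpace_algPoints_of_isProper_holds _ ℂ
    exact A.isAnalytification.homeomorph.symm.compactSpace
  have hrk : ∀ (s : ComplexPoints S) (A : HodgeModel n (fiberOver f s)),
      finrank ℝ A.model = 2 * n := fun s A ↦ by
    rw [finrank_real_of_complex, A.isAnalytification.finrank_eq]
  /- ### Degrees `k > 2n`: both sides vanish -/
  rcases le_or_gt k (2 * n) with hk | hk
  swap
  · refine Eventually.of_forall fun s A ↦ ?_
    haveI := hcpt s A
    letI csE : ChartedSpace (EuclideanSpace ℝ (Fin (2 * n))) A.model :=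
      ((ContinuousLinearEquiv.ofFinrankEq (by rw [hrk s A, finrank_euclideanSpace_fin]) :
        A.model ≃L[ℝ] EuclideanSpace ℝ (Fin (2 * n))).toHomeomorph.toOpenPartialHomeomorph
        |>.singletonChartedSpace (by simp))
    letI : ChartedSpace (EuclideanSpace ℝ (Fin (2 * n))) A.carrier :=
      ChartedSpace.comp (EuclideanSpace ℝ (Fin (2 * n))) A.model A.carrier
    haveI : Subsingleton (singularCohomology ℂ ℂ A.carrier k) :=
      subsingleton_singularCohomology_of_lt ℂ (2 * n) A.carrier hk
    have hbot : A.hodgePQ k p q = ⊥ := Subsingleton.elim _ _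
    rw [hbot, finrank_bot]
    exact Nat.zero_le _
  /- ### Degrees `k ≤ 2n`: sequences and the analytic theorem -/
  by_contra hnot
  set h₀ := finrank ℂ ↥(A₀.hodgePQ k p q) with hh₀
  have hfreq : ∃ᶠ s in 𝓝 s₀, ∃ A : HodgeModel n (fiberOver f s),
      h₀ + 1 ≤ finrank ℂ ↥(hodgePQ A.model A.carrier k p q) := by
    rw [not_eventually] at hnot
    refine hnot.mono fun s hs ↦ ?_
    push Not at hs
    obtain ⟨A, hA⟩ := hs
    exact ⟨A, by rw [← hfin]; omega⟩
  obtain ⟨sq, hsq, hAex⟩ := exists_seq_forall_of_frequently hfreq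
  choose A hA using hAex
  -- instances on the carriers of the chosen models
  haveI : ∀ i, CompactSpace (A i).carrier := fun i ↦ hcpt _ (A i)
  haveI : CompactSpace A₀.carrier := hcpt _ A₀
  haveI : ∀ i, Fact (finrank ℝ (A i).model = 2 * n) := fun i ↦ ⟨hrk _ (A i)⟩
  haveI : Fact (finrank ℝ A₀.model = 2 * n) := ⟨hrk _ A₀⟩
  obtain ⟨h0c, h0i, h0d, h0J, h0r⟩ := hfib s₀ A₀
  have key := le_finrank_hodgePQ_of_fibres GT hGT hπ isOpen_univ (mem_univ s₀) hsub hprop hsq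
    h0c h0i h0d h0J h0r (fun i ↦ (A i).model) (fun i ↦ (A i).carrier)
    (fun i a ↦ AlgPoints.map (fiberι f (sq i)) ((A i).toComplexPoints a))
    (fun i ↦ (hfib _ (A i)).1) (fun i ↦ (hfib _ (A i)).2.1) (fun i ↦ (hfib _ (A i)).2.2.1)
    (fun i ↦ (hfib _ (A i)).2.2.2.1) (fun i ↦ (hfib _ (A i)).2.2.2.2) hk hA
  rw [← hfin] at key
  omega

end Family

end Literature.AlgebraicGeometry.Motives
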